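import Summits.HodgeConjecture.HodgeConjecture.Theorems.Ring2WeilCoveragePowers
import HarnessLib

/-!
# Ring 2 · Weil-type family-coverage census (ring2-b05, gen 57, file 2) — EVEN POWERS OF EVERY WEIL-TYPE PAIR ARE
  SPLIT: the datum-free forms of `Ring2WeilCoveragePowers` §2 / §4

research route conditional on HC_CM; not a corollary; Q11.4-sentence-2 already refuted in dim ≥ 3.
`HC_CM` (`Theses.RankFourFaces.CMAbelianHodge`, by name) does not occur in this file; no case of the Hodge conjecture is
claimed. Cell `pub-hodge-ring2`, seat `ring2-b05` (census «## b05 (g ≥ 8 / powers)», block b05.2 POWERS COLUMN).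
No definition, no named fact, no `sorry`.

`Ring2WeilCoveragePowers` states its parity theorems relative to a GIVEN polarised datum `(e, a)` of non-degenerate class
`δ` (the shape of the census rows). By van Geemen's Lemma 5.2 (1)–(3) ON THE CARRIERS
(`VanGeemen1994.exists_projectiveEmbedding_hasWeilDiscriminantNondeg`: EVERY `(A, φ)` with `dim A = 2n ≥ 2`, `φ² = -d`,
`d ≥ 1` carries a projective embedding and a rational ambient class whose `K`-symmetrised hyperplane class has
non-degenerate discriminant of SOME class) the datum can be dropped from the hypotheses:

* `isSplitWeilType_powSucc_of_isWeilType_of_odd` — **every EVEN power `(A^{k+1}, φ^{k+1})` (`k` odd) of EVERY pair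
  `(A, φ)` of Weil type `(n, d)` is of SPLIT Weil type `((k+1)n, d)`**; `isSplitWeilType_sq_of_isWeilType` — the square.
* `weilClassesOf_sq_fourfold_le_algebraicClasses_of_splitEightfolds_of_isWeilType` — granted R2₈
  `WeilTypeLadder.SplitEightfolds` (binder), the Weil classes of `X²` are algebraic for EVERY Weil-type fourfold `X`;
  `weilClassesOf_powSucc_le_algebraicClasses_of_splitWeilAbelianVarieties_of_isWeilType` — granted R2 (binder), those of
  every even power of every Weil-type `(A, φ)` with `n ≥ 2`.

## References
* [vanGeemen1994HodgeAV] B. van Geemen, LNM 1594 (1994), Lemma 5.2 (1)–(4), 5.4 and (5.4.1).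
* [MoonenZarhin1999LowDim] B. Moonen, Yu. Zarhin, Math. Ann. 315 (1999), (1.9).
* [Landherr1936HermitianForms] W. Landherr, Abh. Math. Sem. Hamburg 11 (1936).
-/

set_option linter.dupNamespace false -- `Summit.HodgeConjecture.HodgeConjecture.…` (summit = problem) trips it

noncomputable section

open CategoryTheory

namespace Summit.HodgeConjecture.HodgeConjecture.Ring2.WeilCoverage

open Literature.AlgebraicGeometry Literature.AlgebraicGeometry.Motives
open Literature.AlgebraicGeometry.HodgeTheory Literature.AlgebraicGeometry.VanGeemen1994
open Literature.AlgebraicTopology.SingularHomology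
open Summit.HodgeConjecture.HodgeConjecture.Ring2.Hypotheses

variable {A : AbelianVariety ℂ} {φ : A ⟶ A} {n d : ℕ}

/-- **EVERY EVEN POWER OF EVERY WEIL-TYPE PAIR IS OF SPLIT WEIL TYPE** (datum-free): if `(A, φ)` is of Weil type
`(n, d)` and `k` is odd, then `(A^{k+1}, φ^{k+1}) = (A.powSucc k, powSuccMap φ k)` is of SPLIT Weil type `((k+1)n, d)`.
Van Geemen 5.2 (1)–(3) supplies a polarised datum of some non-degenerate class `δ` on `A`
(`VanGeemen1994.exists_projectiveEmbedding_hasWeilDiscriminantNondeg`); then `Ring2WeilCoveragePowers`'s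
`isSplitWeilType_powSucc_of_odd` (`δ^{k+1} = 1 = [(-1)^{(k+1)n}]`, Landherr's converse on the carriers).
[cite: vanGeemen1994HodgeAV, Lemma 5.2 (1)–(4), 5.4 and (5.4.1)] [cite: Landherr1936HermitianForms]
[cite: MoonenZarhin1999LowDim, (1.9)] -/
theorem isSplitWeilType_powSucc_of_isWeilType_of_odd (hW : IsWeilType A φ n d) {k : ℕ} (hk : Odd k) :
    IsSplitWeilType (A.powSucc k) (powSuccMap φ k) ((k + 1) * n) d := by
  obtain ⟨e, a, δ, ha, ha0, hWA⟩ :=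
    exists_projectiveEmbedding_hasWeilDiscriminantNondeg hW.pos hW.dim_eq hW.d_pos hW.sq_eq
  exact isSplitWeilType_powSucc_of_odd hW e ha ha0 hWA hk

/-- **THE SQUARE OF EVERY WEIL-TYPE PAIR IS OF SPLIT WEIL TYPE**: `(A × A, φ × φ)` — spelled `(A.powSucc 1, powSuccMap φ 1)`
— is of split Weil type `(2n, d)` whenever `(A, φ)` is of Weil type `(n, d)` (any discriminant class of `A`). E.g. the
square of a NON-split Weil fourfold is a split Weil eightfold (census b01.8.2 (P8a)).
[cite: vanGeemen1994HodgeAV, Lemma 5.2 (1)–(4), 5.4 and (5.4.1)] [cite: Landherr1936HermitianForms] -/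
theorem isSplitWeilType_sq_of_isWeilType (hW : IsWeilType A φ n d) :
    IsSplitWeilType (A.powSucc 1) (powSuccMap φ 1) (2 * n) d := by
  have h := isSplitWeilType_powSucc_of_isWeilType_of_odd hW odd_one
  rwa [show (1 + 1) * n = 2 * n by ring] at h

/-- **Granted R2₈ `WeilTypeLadder.SplitEightfolds` ALONE (binder `h8`), the Weil classes of `X²` are algebraic for EVERY
Weil-type fourfold `(X, φ)` of type `(2, d)`** — datum-free form of
`weilClassesOf_sq_fourfold_le_algebraicClasses_of_splitEightfolds`. [cite: vanGeemen1994HodgeAV, Lemma 5.2, 5.4 and (5.4.1)]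
[cite: Markman2025SecantWeil, §1.2 (preprint)] -/
theorem weilClassesOf_sq_fourfold_le_algebraicClasses_of_splitEightfolds_of_isWeilType
    (h8 : WeilTypeLadder.SplitEightfolds) (hW : IsWeilType A φ 2 d) :
    weilClassesOf (A.powSucc 1) (powSuccMap φ 1) 4 d ≤ algebraicClasses (A.powSucc 1).X 4 := by
  obtain ⟨e, a, δ, ha, ha0, hWA⟩ :=
    exists_projectiveEmbedding_hasWeilDiscriminantNondeg hW.pos hW.dim_eq hW.d_pos hW.sq_eq
  exact weilClassesOf_sq_fourfold_le_algebraicClasses_of_splitEightfolds h8 hW e ha ha0 hWA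

/-- **Granted R2 `WeilTypeLadder.SplitWeilAbelianVarieties` ALONE (binder `h`), the Weil classes of every EVEN power of
every Weil-type pair `(A, φ)` of type `(n, d)` with `n ≥ 2` are algebraic** — datum-free form of
`weilClassesOf_powSucc_le_algebraicClasses_of_splitWeilAbelianVarieties`. [cite: vanGeemen1994HodgeAV, Lemma 5.2, 5.4 and (5.4.1)]
[cite: Markman2025SurveySecant, §12 (preprint)] -/
theorem weilClassesOf_powSucc_le_algebraicClasses_of_splitWeilAbelianVarieties_of_isWeilType
    (h : WeilTypeLadder.SplitWeilAbelianVarieties) (hW : IsWeilType A φ n d) (hn : 2 ≤ n) {k : ℕ} (hk : Odd k) :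
    weilClassesOf (A.powSucc k) (powSuccMap φ k) ((k + 1) * n) d ≤
      algebraicClasses (A.powSucc k).X ((k + 1) * n) := by
  obtain ⟨e, a, δ, ha, ha0, hWA⟩ :=
    exists_projectiveEmbedding_hasWeilDiscriminantNondeg hW.pos hW.dim_eq hW.d_pos hW.sq_eq
  exact weilClassesOf_powSucc_le_algebraicClasses_of_splitWeilAbelianVarieties h hW hn e ha ha0 hWA hk

end Summit.HodgeConjecture.HodgeConjecture.Ring2.WeilCoverage

end
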